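import Summits.PneNP.PneNP.Theorems.KarlinRubinMonotoneBlindCoverCompleteness
import Summits.PneNP.PneNP.Theorems.KarlinRubinMonotoneBlindCnf

/-!
# Crux `MonotoneBlind` (stmt-PneNP-18027, route KarlinRubin), line `Sketch`: the cover certificate for quiet polynomial-clause CNFs

Second class instance of the hard stub `stub_coverCertificate` of line `Sketch`, obtained exactly like
the DNF instance (`KarlinRubinMonotoneBlindCoverDnf.lean`): the completeness engine
`coverCertificate_of_plantedAcceptance_tendsto_zero` (Park–Pham at the larger clique) fed with the
landed depth-2 AND-side theorem `Summit.PneNP.PneNP.Theorems.karlinRubin_cnf_planted_tendsto_zero`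
(quiet monotone CNFs with `≤ n^c` clauses have vanishing planted acceptance at every exponent):

* `coverCertificate_cnf` — for `0 < δ < 1/2`, `c`, clause families `𝓒 n` with `#(𝓒 n) ≤ n^c`
  eventually and null acceptance `→ 0`, and every `η > 0`: the `G(n,1/2)`-probability that the
  clique-completion up-set `{A | ∀ S ∈ 𝓒 n, S meets x ∪ K_A}` has NO cover of `(⌈n^{1/2-δ}⌉/n)`-cost
  `≤ η` tends to `0`.

All `--supports stmt-PneNP-18027`; no definitions.
-/

set_option linter.dupNamespace false -- `Summit.PneNP.PneNP.…` is the layout-mandated namespace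

namespace Summit.PneNP.PneNP.Theorems.MonotoneBlind.VertexCover

open Literature.Computability.Complexity Literature.Probability.RandomGraphs.PlantedClique Filter Finset
open scoped ENNReal Topology Classical

/-- **The cover certificate for quiet polynomial-clause monotone CNFs.** For `0 < δ < 1/2` and `c`,
if `#(𝓒 n) ≤ n^c` eventually and `Pr_{G(n,1/2)}[∀ S ∈ 𝓒 n, ∃ e ∈ S, x e] → 0`, then for every
`η > 0` the probability that the up-set `{A | ∀ S ∈ 𝓒 n, ∃ e ∈ S, plant A x e}` has no cover `G`
with `∑_{S ∈ G} (d/n)^{|S|} ≤ η`, `d = min ⌈n^{1/2-δ}⌉ n`, tends to `0`. Proof: the CNF test is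
monotone and strongly blind at `δ/2` (`karlinRubin_cnf_planted_tendsto_zero`); apply
`coverCertificate_of_plantedAcceptance_tendsto_zero`. [folklore] -/
theorem coverCertificate_cnf :
    ∀ δ : ℝ, 0 < δ → δ < 1 / 2 → ∀ c : ℕ,
      ∀ 𝓒 : (n : ℕ) → Finset (Finset (⊤ : SimpleGraph (Fin n)).edgeSet),
      (∀ᶠ n : ℕ in atTop, #(𝓒 n) ≤ n ^ c) →
      Tendsto (fun n : ℕ =>
        (erdosRenyiHalf n).toOuterMeasure {x | ∀ S ∈ 𝓒 n, ∃ e ∈ S, x e = true}) atTop (𝓝 0) →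
      ∀ η : ℝ≥0∞, 0 < η →
        Tendsto (fun n : ℕ => (erdosRenyiHalf n).toOuterMeasure
          {x | ¬ ∃ G : Finset (Finset (Fin n)),
            (∀ A : Finset (Fin n), (∀ S ∈ 𝓒 n, ∃ e ∈ S, plant A x e = true) → ∃ S ∈ G, S ⊆ A) ∧
              ∑ S ∈ G, ((((min ⌈(n : ℝ) ^ (1 / 2 - δ)⌉₊ n : ℕ) : ℝ≥0∞) / (n : ℝ≥0∞)) ^ S.card) ≤ η})
          atTop (𝓝 0) := by
  intro δ hδ hδ' c 𝓒 hM hquiet η hη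
  -- the CNF test as a Boolean function
  set f : (n : ℕ) → EdgeVec n → Bool := fun n x => decide (∀ S ∈ 𝓒 n, ∃ e ∈ S, x e = true) with hf
  have hset : ∀ n : ℕ, {y : EdgeVec n | f n y = true} = {x | ∀ S ∈ 𝓒 n, ∃ e ∈ S, x e = true} := by
    intro n
    ext y
    simp only [hf, Set.mem_setOf_eq, decide_eq_true_eq]
  have hmono : ∀ᶠ n : ℕ in atTop, Monotone (f n) := by
    refine Eventually.of_forall fun n x y hxy => ?_
    simp only [hf]
    rw [Bool.le_iff_imp, decide_eq_true_eq, decide_eq_true_eq]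
    intro h S hS
    obtain ⟨e, he, hex⟩ := h S hS
    refine ⟨e, he, ?_⟩
    have h' := hxy e
    rw [hex] at h'
    exact top_le_iff.1 h'
  -- strong blindness of the CNF at `δ/2`
  have hP : Tendsto (fun n : ℕ => (plantedCliqueDist n ⌈(n : ℝ) ^ (1 / 2 - δ / 2)⌉₊).toOuterMeasure
      {y | f n y = true}) atTop (𝓝 0) := by
    simp only [hset]
    exact Summit.PneNP.PneNP.Theorems.karlinRubin_cnf_planted_tendsto_zero (by linarith) (by linarith) c 𝓒 hM hquiet
  have h := coverCertificate_of_plantedAcceptance_tendsto_zero f hmono (by linarith : 0 < δ / 2)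
    (by linarith : δ / 2 < δ) hδ' hP η hη
  refine h.congr' (Eventually.of_forall fun n => ?_)
  simp only [hf, decide_eq_true_eq]

end Summit.PneNP.PneNP.Theorems.MonotoneBlind.VertexCover
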